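import Summits.QuantumFields.YangMills.Theorems.ColdStartUniversalityLindebergSwapSmallFieldContinuity
import Literature.MathematicalPhysics.QuantumFieldTheory.Balaban1983to89.T3UnitLawDensityEML
import HarnessLib

/-!
# Crux `ColdStartContinuumCauchy` (stmt-QuantumFields-24810, route `ColdStartUniversality`), LINE 3 «lindeberg_swap»:
# ABSOLUTE CONTINUITY OF THE ITERATED AVERAGING PUSH-FORWARDS (product Haar)

Helper file (seat `ym-line-csu-p1`, g9; `--supports stmt-QuantumFields-24810`).  Brick (a3) of the proof plan for the registered rung
`stub_shortWindowSwap` (memo v3 on the crux).  Product Haar measure on the configurations of Bałaban's `K`-th approximation, pushed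
forward under
* the reading map `toField K` (a relabelling of the factors — measure PRESERVING: `map_toField_pi_haar`),
* the `i`-fold guarded averaging of record `Averaging.iter blockAvg i` (ABSOLUTELY CONTINUOUS w.r.t. product Haar on the level-`i` fields,
  `map_iter_absolutelyContinuous`, by induction from the tree's one-step `T3UnitLawDensityEML.haarAC_blockAvg`
  = `BlockAveragingEMLHaarAC.haarAC_avgFun_expMeanLogSU`),
* the swap map read on coarse fields, `toField K ∘ stepDown K = fieldShift ∘ avg₀ ∘ toField (K+1)` (ABSOLUTELY CONTINUOUS,
  `map_toField_stepDown_absolutelyContinuous`; the level identification `fieldShift` is measure preserving, `T3LevelShift`),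
so that product-Haar-NULL sets of level-`i` fields (resp. of coarse level-0 fields) pull back to null sets of configurations
(`pi_haar_null_preimage_iter_toField`, `pi_haar_null_preimage_toField_stepDown`).  With bricks (a1)/(a2) (the guard level sets are null) this
gives (a5): the discontinuity sets of `…LindebergSwapRegularContinuity` are invisible to any law with a density.
THEOREMS ONLY, no sorry.  HONEST FRAMING: plumbing; no crux, rung or summit is proved; the Yang–Mills mass gap is NOT proved.
-/

set_option autoImplicit false

noncomputable section

namespace Summit.QuantumFields.YangMills.Cruxes.ColdStartContinuumCauchy.LindebergSwap

open scoped BigOperators NNReal ENNReal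
open MeasureTheory Set Function
open Literature.MathematicalPhysics.QuantumFieldTheory
open Literature.MathematicalPhysics.QuantumFieldTheory.Balaban1983to89
open Literature.MathematicalPhysics.QuantumLattice
open Literature.MathematicalPhysics.QuantumFieldTheory.Balaban1983to89.BlockAveraging (blockAvg blockAvg_avg avgFun)

variable (F : T3ContinuumYM3Torus.T3Family)

/-! ## §1 Relabellings preserve product Haar -/

/-- **`toField K` pushes product Haar on configurations to product Haar on level-0 fields** (the bonds `b ↦ (b.src, b.dir)` biject onto
the edges). [folklore] -/
theorem map_toField_pi_haar (K : ℕ) :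
    (Measure.pi fun _ : Edge 3 ((F.P K).sitesPerDir 0) => (HaarData.haar : Measure G2)).map (toField F K) =
      fieldMeasure (F.P K) 0 G2 := by
  classical
  symm
  unfold fieldMeasure
  refine Measure.pi_eq fun s hs => ?_
  have hmt : Measurable (toField F K) := measurable_pi_lambda _ fun b => measurable_pi_apply _
  have h1 := Measure.map_apply (μ := Measure.pi fun _ : Edge 3 ((F.P K).sitesPerDir 0) => (HaarData.haar : Measure G2))
    hmt (MeasurableSet.univ_pi hs)
  refine h1.trans ?_
  -- the preimage of a box is the relabelled box
  have hpre : toField F K ⁻¹' Set.pi Set.univ s =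
      Set.pi Set.univ (fun e : Edge 3 ((F.P K).sitesPerDir 0) => s ⟨e.1, e.2⟩) := by
    ext c
    constructor
    · intro h e _
      exact h ⟨e.1, e.2⟩ (Set.mem_univ _)
    · intro h b _
      exact h (b.src, b.dir) (Set.mem_univ _)
  rw [hpre]
  show (Measure.pi fun _ : Edge 3 ((F.P K).sitesPerDir 0) => (HaarData.haar : Measure G2))
      (Set.pi Set.univ fun e : Edge 3 ((F.P K).sitesPerDir 0) => s ⟨e.1, e.2⟩) = _
  rw [Measure.pi_pi]
  -- reindex the finite product along the bijection `b ↦ (b.src, b.dir)`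
  exact Fintype.prod_equiv ⟨fun e => ⟨e.1, e.2⟩, fun b => (b.src, b.dir), fun e => rfl, fun b => rfl⟩ _ _ (fun e => rfl)

/-! ## §2 The iterated averaging pushes product Haar to an absolutely continuous measure -/

/-- **`(Haar_0).map (Averaging.iter blockAvg i) ≪ Haar_i`** for the printed `SU(2)` averaging of the `K`-th approximation, in the
standing range `i ≤ m + K` (induction over the one-step `HaarAC`). [cite: Balaban1985Averaging, (10) p.19] -/
theorem map_iter_absolutelyContinuous (K : ℕ) :
    ∀ i : ℕ, i ≤ F.m + K →
      (fieldMeasure (F.P K) 0 G2).map (Averaging.iter (fun j => (blockAvg (P := F.P K) (j := j) avSU : Averaging (F.P K) j G2)) i) ≪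
        fieldMeasure (F.P K) i G2
  | 0, _ => by
    change (fieldMeasure (F.P K) 0 G2).map id ≪ _
    rw [Measure.map_id]
  | i + 1, hi => by
    have ih := map_iter_absolutelyContinuous K i (Nat.le_of_succ_le hi)
    have hstep : T4FiniteEpsInhabited.HaarAC (blockAvg (P := F.P K) (j := i) avSU).avg :=
      T3UnitLawDensityEML.haarAC_blockAvg F K hi
    have hmi : Measurable (Averaging.iter (fun j => (blockAvg (P := F.P K) (j := j) avSU : Averaging (F.P K) j G2)) i) :=
      T4Continuum.measurable_iter _ (fun j => F.avgMeasurable_of_measurableE avSU T4ApexTwoLevel.measurableE_expMeanLogSU K j) i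
    have hma : Measurable (blockAvg (P := F.P K) (j := i) avSU).avg :=
      F.avgMeasurable_of_measurableE avSU T4ApexTwoLevel.measurableE_expMeanLogSU K i
    change (fieldMeasure (F.P K) 0 G2).map ((blockAvg avSU).avg ∘ Averaging.iter _ i) ≪ _
    rw [← Measure.map_map hma hmi]
    exact (ih.map hma).trans hstep

/-- **Product-Haar-null sets of level-`i` fields pull back to null sets of configurations** under `Averaging.iter blockAvg i ∘ toField K`
(`i ≤ m + K`). [folklore] -/
theorem pi_haar_null_preimage_iter_toField (K i : ℕ) (hi : i ≤ F.m + K) {N : Set (GaugeField (F.P K) i G2)}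
    (hN : fieldMeasure (F.P K) i G2 N = 0) :
    (Measure.pi fun _ : Edge 3 ((F.P K).sitesPerDir 0) => (HaarData.haar : Measure G2))
      ((fun u => Averaging.iter (fun j => (blockAvg (P := F.P K) (j := j) avSU : Averaging (F.P K) j G2)) i (toField F K u)) ⁻¹' N)
        = 0 := by
  have hmi : Measurable (Averaging.iter (fun j => (blockAvg (P := F.P K) (j := j) avSU : Averaging (F.P K) j G2)) i) :=
    T4Continuum.measurable_iter _ (fun j => F.avgMeasurable_of_measurableE avSU T4ApexTwoLevel.measurableE_expMeanLogSU K j) i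
  have hmt : Measurable (toField F K) := measurable_pi_lambda _ fun b => measurable_pi_apply _
  have hac : (Measure.pi fun _ : Edge 3 ((F.P K).sitesPerDir 0) => (HaarData.haar : Measure G2)).map
      (fun u => Averaging.iter (fun j => (blockAvg (P := F.P K) (j := j) avSU : Averaging (F.P K) j G2)) i (toField F K u)) ≪
      fieldMeasure (F.P K) i G2 := by
    have h := map_iter_absolutelyContinuous F K i hi
    rw [← map_toField_pi_haar F K, Measure.map_map hmi hmt] at h
    exact h
  have h0 := hac hN
  exact nonpos_iff_eq_zero.mp ((Measure.le_map_apply (hmi.comp hmt).aemeasurable N).trans h0.le)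

/-! ## §3 Through the one-step map `stepDown` -/

/-- **`toField K ∘ stepDown K` pushes product Haar on the fine configurations to a measure absolutely continuous w.r.t. product Haar on
the coarse level-0 fields**: `toField ∘ stepDown = fieldShift ∘ avg₀ ∘ toField` (`StepDown.toField_stepDown`), the averaging step is
`HaarAC`, and the level identification `fieldShift` is measure preserving (`T3LevelShift.measurePreserving_fieldShift`).
[cite: Balaban1985Averaging, (10) p.19] -/
theorem map_toField_stepDown_absolutelyContinuous (K : ℕ) :
    (Measure.pi fun _ : Edge 3 ((F.P (K + 1)).sitesPerDir 0) => (HaarData.haar : Measure G2)).map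
        (fun u' => toField F K (stepDown F K u')) ≪ fieldMeasure (F.P K) 0 G2 := by
  -- the three maps, typed on the `F.P` towers
  let tf : GaugeConfig 3 ((F.P (K + 1)).sitesPerDir 0) G2 → GaugeField (F.P (K + 1)) 0 G2 := toField F (K + 1)
  let av : GaugeField (F.P (K + 1)) 0 G2 → GaugeField (F.P (K + 1)) 1 G2 := (blockAvg (P := F.P (K + 1)) (j := 0) avSU).avg
  let fs : GaugeField (F.P (K + 1)) 1 G2 → GaugeField (F.P K) 0 G2 :=
    T3LevelShift.fieldShift (StepDown.sitesPerDir_zero_eq_succ_one F K)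
  have hmt : Measurable tf := measurable_pi_lambda _ fun b => measurable_pi_apply _
  have hma : Measurable av := F.avgMeasurable_of_measurableE avSU T4ApexTwoLevel.measurableE_expMeanLogSU (K + 1) 0
  have hfs := T3LevelShift.measurePreserving_fieldShift (F := F) (G := G2) (StepDown.sitesPerDir_zero_eq_succ_one F K)
  have hmf : Measurable fs := hfs.measurable
  have hstep : (fieldMeasure (F.P (K + 1)) 0 G2).map av ≪ fieldMeasure (F.P (K + 1)) 1 G2 :=
    T3UnitLawDensityEML.haarAC_blockAvg F (K + 1) (by have := F.hm; omega)
  -- the swap map read on coarse fields is the composite `fs ∘ av ∘ tf`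
  have heq : (fun u' => toField F K (stepDown F K u')) = fs ∘ (av ∘ tf) := by
    funext u'
    exact StepDown.toField_stepDown F K u'
  have h1 : ((Measure.pi fun _ : Edge 3 ((F.P (K + 1)).sitesPerDir 0) => (HaarData.haar : Measure G2)).map tf).map av ≪
      fieldMeasure (F.P (K + 1)) 1 G2 := by
    rw [map_toField_pi_haar F (K + 1)]
    exact hstep
  have h2 : (((Measure.pi fun _ : Edge 3 ((F.P (K + 1)).sitesPerDir 0) => (HaarData.haar : Measure G2)).map tf).map av).map fs ≪
      fieldMeasure (F.P K) 0 G2 :=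
    (h1.map hmf).trans (Measure.absolutelyContinuous_of_eq hfs.map_eq)
  have hmaps : (((Measure.pi fun _ : Edge 3 ((F.P (K + 1)).sitesPerDir 0) => (HaarData.haar : Measure G2)).map tf).map av).map fs =
      (Measure.pi fun _ : Edge 3 ((F.P (K + 1)).sitesPerDir 0) => (HaarData.haar : Measure G2)).map (fs ∘ (av ∘ tf)) := by
    rw [Measure.map_map hma hmt, Measure.map_map hmf (hma.comp hmt)]
  rw [heq, ← hmaps]
  exact h2

/-- **Product-Haar-null sets of coarse level-0 fields pull back under `toField K ∘ stepDown K` to null sets of fine configurations.**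
[folklore] -/
theorem pi_haar_null_preimage_toField_stepDown (K : ℕ) {N : Set (GaugeField (F.P K) 0 G2)}
    (hN : fieldMeasure (F.P K) 0 G2 N = 0) :
    (Measure.pi fun _ : Edge 3 ((F.P (K + 1)).sitesPerDir 0) => (HaarData.haar : Measure G2))
      ((fun u' => toField F K (stepDown F K u')) ⁻¹' N) = 0 := by
  have hmt : Measurable (toField F K) := measurable_pi_lambda _ fun b => measurable_pi_apply _
  have h0 := map_toField_stepDown_absolutelyContinuous F K hN
  exact nonpos_iff_eq_zero.mp ((Measure.le_map_apply (hmt.comp (measurable_stepDown F K)).aemeasurable N).trans h0.le)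

end Summit.QuantumFields.YangMills.Cruxes.ColdStartContinuumCauchy.LindebergSwap

end
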